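import Literature.MathematicalPhysics.QuantumLattice.XYOrderInfraredProofs
import Literature.LinearAlgebra.Matrix.PosSemidefTrace
import Mathlib.Algebra.QuadraticDiscriminant
import HarnessLib

/-!
# The Kennedy–Lieb–Shastry ground-state infrared bound holds in EVERY ground state

Kennedy–Lieb–Shastry (J. Stat. Phys. 53 (1988) 1019, eqs. (12)–(14), (18)–(19)) derive, from Gaussian
domination in its ground-state ENERGY form `(GD_V,Q): E₀(H) ≤ E₀(H + tV + ½t²Q)` for all real `t`
(`H`, `V` Hermitian, `Q` real), the infrared bound `ω(V²)² ≤ ½Q·ω(V(H−E₀)V) = ¼Q·ω([V,[H,V]])` by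
second-order perturbation theory done variationally with the trial operator `1 + tμV`. The tree proves
this for the TRACIAL ground state `ω = tr(P₀ ·)/tr P₀` (`Matrix.groundState_infraredBound`,
`XYOrderInfraredProofs.lean`). This file proves it for EVERY state supported on the ground space —
every `ρ ⪰ 0` with `Hρ = E₀ρ`: every ground-state VECTOR of a possibly degenerate ground level
(`ρ = |ψ⟩⟨ψ|`), every mixture of ground states, and `ρ = P₀` as a special case. The argument is the
printed one run with the trial family `(1 + sV)ρ(1 + sV)`; no idempotency of `ρ` is used, only
`(H − E₀)ρ = 0 = ρ(H − E₀)` and `Re tr(ρ'M) ≥ 0` for `ρ', M ⪰ 0`.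

Results (all PROVED; no definition, no named fact): `trace_conj_trial_mul_expansion` (the trial-state
polynomial identity); `trace_mul_eq_zero_of_gaussianDomination` (first order: `tr(ρV) = 0`);
`infraredBound_quadratic_of_groundSupported` (`0 ≤ ½Q·trρ + 2μ·Re tr(ρV²) + μ²·Re tr(ρV(H−E₀)V)`);
`infraredBound_of_groundSupported` (`(Re tr ρV²)² ≤ ½Q·Re trρ·Re tr(ρV(H−E₀)V)`);
`trace_mul_sub_mul_eq_half_doubleCommutator` (KLS (13) bookkeeping `tr(ρV(H−E₀)V) = ½tr(ρ[V,[H,V]])`)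
and `infraredBound_doubleCommutator_of_groundSupported`; the CERTIFIED-INPUT COROLLARY
`trace_sq_le_half_sqrt_of_groundSupported`: for a ground-supported density matrix, `(GD_V,Q)` with
`0 ≤ Q` and a double-commutator ceiling `Re tr(ρ[V,[H,V]]) ≤ D` give the MODE CEILING
`Re tr(ρV²) ≤ ½√(QD)` (finitely many certified numbers per mode feeding a sum-rule step); the
TWO-MODE PACKAGING `infraredBound_twoModes_of_groundSupported` (cosine + sine wave of one wave vector,
the shape a structure-factor ceiling `|Λ|S(q) = ⟨C_q²⟩ + ⟨D_q²⟩` consumes, cf.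
`xy_infraredBound_of_groundEnergy_le`); VECTOR FORMS `dotProduct_mulVec_eq_zero_of_gaussianDomination`,
`infraredBound_of_mulVec_eq`, `infraredBound_of_isGroundStateVector`.

Scope (not a claim): summit-side long-range-order statements (`HubbardSuperconductivity`: EVERY sequence
of sector ground states) and ground-state certificates ("every ground-state density matrix", cf.
`Literature.Barriers.HubbardSuperconductivity.OrderParameterInvisibleToGroundStateConstraints`) quantify
over all ground states, not the tracial one; `a² ≤ ½Q·b` is convex in the state-linear pair `(a, b)`,
so the per-vector form implies the mixed ones, but the direct proof for all ground-supported `ρ` is no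
longer. NOT here: no claim that `(GD_V,Q)` holds for any model or mode (for reflection-positive models
it is Dyson–Lieb–Simon / Kennedy–Lieb–Shastry Gaussian domination, `XYOrderInfrared.lean`; for a generic
perturbation or a doped lattice-fermion model it is an open hypothesis — the tree's crux
`XYStabilityTransfer.UniformMeanGDn` is its zone-averaged form); no sum rule, no lattice Fourier
analysis (`XYOrderInfraredProofs` / `XYStabilityTransfer`).

## References
* T. Kennedy, E. H. Lieb, B. S. Shastry, J. Stat. Phys. 53 (1988) 1019–1030 [KLS1988JSP],
  eqs. (12)–(14), (18)–(19).
* F. J. Dyson, E. H. Lieb, B. Simon, J. Stat. Phys. 18 (1978) 335–383 [DysonLiebSimon1978];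
  H. Tasaki, *Physics and Mathematics of Quantum Many-Body Systems* (2020), §4.4 [Tasaki2020].
-/
noncomputable section

open Matrix Finset Filter Topology
open scoped ComplexOrder

namespace Literature.MathematicalPhysics.QuantumLattice

variable {m : Type*} [Fintype m] [DecidableEq m]

omit [DecidableEq m] in
/-- `Tr((x y) M) = y ⬝ (M x)`: the trace against a rank-one matrix is a matrix element. [folklore] -/
private theorem trace_vecMulVec_mul (x y : m → ℂ) (M : Matrix m m ℂ) :
    (vecMulVec x y * M).trace = y ⬝ᵥ (M *ᵥ x) := by
  simp only [Matrix.trace, Matrix.diag_apply, Matrix.mul_apply, vecMulVec_apply, dotProduct,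
    mulVec, Finset.mul_sum]
  rw [Finset.sum_comm]
  refine Finset.sum_congr rfl fun j _ => Finset.sum_congr rfl fun i _ => ?_
  ring

omit [DecidableEq m] in
/-- `A (x y) = (A x) y` for a rank-one matrix. [folklore] -/
private theorem mul_vecMulVec_eq (A : Matrix m m ℂ) (x y : m → ℂ) :
    A * vecMulVec x y = vecMulVec (A *ᵥ x) y := by
  ext i j
  simp only [Matrix.mul_apply, vecMulVec_apply, mulVec, dotProduct, Finset.sum_mul]
  refine Finset.sum_congr rfl fun k _ => ?_
  ring

/-- **The trial-state trace expansion** of Kennedy–Lieb–Shastry's variational second-order argument: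
for `Kρ = ρK = 0` and real `t, s, c`, `tr((1+sV)ρ(1+sV)(K + tV + c)) = t·tr(ρV) + c·trρ +
2s(t·tr(ρV²) + c·tr(ρV)) + s²(tr(ρVKV) + t·tr(ρV³) + c·tr(ρV²))` (done inline for `ρ = P₀` in the tree's
`Matrix.groundState_infraredBound_quadratic`). [cite: KLS1988JSP, eqs. (18)–(19)] -/
theorem trace_conj_trial_mul_expansion {ρ K V : Matrix m m ℂ} (hKρ : K * ρ = 0) (hρK : ρ * K = 0)
    (t s c : ℝ) :
    ((1 + (s : ℂ) • V) * ρ * (1 + (s : ℂ) • V) * (K + (t : ℂ) • V + (c : ℂ) • (1 : Matrix m m ℂ))).trace =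
      (t : ℂ) * (ρ * V).trace + (c : ℂ) * ρ.trace +
        ((2 * s : ℝ) : ℂ) * ((t : ℂ) * (ρ * (V * V)).trace + (c : ℂ) * (ρ * V).trace) +
        ((s ^ 2 : ℝ) : ℂ) * ((ρ * (V * K * V)).trace + (t : ℂ) * (ρ * (V * V * V)).trace +
          (c : ℂ) * (ρ * (V * V)).trace) := by
  set M : Matrix m m ℂ := K + (t : ℂ) • V + (c : ℂ) • 1 with hM_def
  -- `(1+sV) ρ (1+sV) = ρ + sVρ + sρV + s² VρV`
  have hexp : (1 + (s : ℂ) • V) * ρ * (1 + (s : ℂ) • V) =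
      ρ + (s : ℂ) • (V * ρ) + (s : ℂ) • (ρ * V) + ((s : ℂ) * (s : ℂ)) • (V * ρ * V) := by
    rw [add_mul, one_mul, Matrix.smul_mul, mul_add, mul_one, add_mul, Matrix.mul_smul,
      Matrix.smul_mul, Matrix.mul_smul, smul_smul]
    abel
  -- the four traces against `M`
  have h1 : (ρ * M).trace = (t : ℂ) * (ρ * V).trace + (c : ℂ) * ρ.trace := by
    rw [hM_def, mul_add, mul_add, hρK, zero_add, trace_add, Matrix.mul_smul, trace_smul,
      Matrix.mul_smul, mul_one, trace_smul, smul_eq_mul, smul_eq_mul]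
  have h2 : (ρ * V * M).trace = (t : ℂ) * (ρ * (V * V)).trace + (c : ℂ) * (ρ * V).trace := by
    have hz : (ρ * V * K).trace = 0 := by
      rw [mul_assoc, trace_mul_cycle', ← mul_assoc, hKρ, zero_mul, trace_zero]
    rw [hM_def, mul_add, mul_add, trace_add, trace_add, Matrix.mul_smul, trace_smul,
      Matrix.mul_smul, mul_one, trace_smul, smul_eq_mul, smul_eq_mul, hz, zero_add, mul_assoc]
  have h3 : (V * ρ * M).trace = (t : ℂ) * (ρ * (V * V)).trace + (c : ℂ) * (ρ * V).trace := by
    have hz : (V * ρ * K).trace = 0 := by rw [mul_assoc, hρK, mul_zero, trace_zero]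
    have hy : (V * ρ * V).trace = (ρ * (V * V)).trace := by
      rw [trace_mul_cycle, trace_mul_comm (V * V) ρ]
    have hx : (V * ρ).trace = (ρ * V).trace := trace_mul_comm V ρ
    rw [hM_def, mul_add, mul_add, trace_add, trace_add, Matrix.mul_smul, trace_smul,
      Matrix.mul_smul, mul_one, trace_smul, smul_eq_mul, smul_eq_mul, hz, zero_add, hy, hx]
  have h4 : (V * ρ * V * M).trace = (ρ * (V * K * V)).trace +
      (t : ℂ) * (ρ * (V * V * V)).trace + (c : ℂ) * (ρ * (V * V)).trace := by
    have hx : (V * ρ * V * K).trace = (ρ * (V * K * V)).trace := by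
      rw [mul_assoc (V * ρ) V K, trace_mul_comm (V * ρ) (V * K), ← mul_assoc,
        trace_mul_cycle (V * K) V ρ, mul_assoc ρ (V * K) V]
    have hy : (V * ρ * V * V).trace = (ρ * (V * V * V)).trace := by
      rw [mul_assoc (V * ρ) V V, trace_mul_comm (V * ρ) (V * V), ← mul_assoc,
        trace_mul_cycle (V * V) V ρ, mul_assoc ρ (V * V) V]
    have hw : (V * ρ * V).trace = (ρ * (V * V)).trace := by
      rw [trace_mul_cycle, trace_mul_comm (V * V) ρ]
    rw [hM_def, mul_add, mul_add, trace_add, trace_add, Matrix.mul_smul, trace_smul,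
      Matrix.mul_smul, mul_one, trace_smul, smul_eq_mul, smul_eq_mul, hx, hy, hw]
  rw [hexp, add_mul, add_mul, add_mul, trace_add, trace_add, trace_add,
    Matrix.smul_mul, Matrix.smul_mul, Matrix.smul_mul, trace_smul, trace_smul, trace_smul,
    smul_eq_mul, smul_eq_mul, smul_eq_mul, h1, h2, h3, h4]
  push_cast
  ring

/-- **KLS eq. (13) bookkeeping, state-generic.** For `ρ` supported on the ground space of `H`
(`Hρ = E₀ρ = ρH`), `tr(ρ V(H−E₀)V) = ½ tr(ρ [V,[H,V]])` with
`[V,[H,V]] = V(HV − VH) − (HV − VH)V`. [cite: KLS1988JSP, eqs. (12)–(13)] -/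
theorem trace_mul_sub_mul_eq_half_doubleCommutator {H V ρ : Matrix m m ℂ} {E₀ : ℂ}
    (hHρ : H * ρ = E₀ • ρ) (hρH : ρ * H = E₀ • ρ) :
    (ρ * (V * (H - E₀ • 1) * V)).trace =
      (1 / 2 : ℂ) * (ρ * (V * (H * V - V * H) - (H * V - V * H) * V)).trace := by
  -- `tr(ρ V² H) = E₀ tr(ρ V²) = tr(ρ H V²)`
  have h1 : (ρ * (V * V * H)).trace = E₀ * (ρ * (V * V)).trace := by
    rw [← mul_assoc, trace_mul_cycle, hHρ, Matrix.smul_mul, trace_smul, smul_eq_mul]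
  have h2 : (ρ * (H * (V * V))).trace = E₀ * (ρ * (V * V)).trace := by
    rw [← mul_assoc, hρH, Matrix.smul_mul, trace_smul, smul_eq_mul]
  have hL : (ρ * (V * (H - E₀ • 1) * V)).trace = (ρ * (V * H * V)).trace - E₀ * (ρ * (V * V)).trace := by
    rw [mul_sub, sub_mul, Matrix.mul_smul, mul_one, Matrix.smul_mul, mul_sub, trace_sub,
      Matrix.mul_smul, trace_smul, smul_eq_mul]
  have hR : (ρ * (V * (H * V - V * H) - (H * V - V * H) * V)).trace =
      2 * (ρ * (V * H * V)).trace - (ρ * (V * V * H)).trace - (ρ * (H * (V * V))).trace := by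
    rw [mul_sub V, sub_mul _ _ V, ← mul_assoc V H V, ← mul_assoc V V H, mul_assoc H V V,
      show V * H * V - V * V * H - (H * (V * V) - V * H * V) =
        (2 : ℂ) • (V * H * V) - V * V * H - H * (V * V) by rw [two_smul]; abel,
      mul_sub, mul_sub, Matrix.mul_smul, trace_sub, trace_sub, trace_smul, smul_eq_mul]
  rw [hL, hR, h1, h2]
  ring

section GroundSupported
variable {H V ρ : Matrix m m ℂ} {Q : ℝ}

/-- `ρ(H − E₀) = 0` from `Hρ = E₀ρ` for Hermitian `H`, `ρ`. [folklore] -/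
private theorem mul_eq_smul_of_hermitian (hH : H.IsHermitian) (hρ : ρ.IsHermitian)
    (hHρ : H * ρ = (H.groundEnergy : ℂ) • ρ) : ρ * H = (H.groundEnergy : ℂ) • ρ := by
  have h := congrArg conjTranspose hHρ
  rw [conjTranspose_mul, conjTranspose_smul, hρ.eq, hH.eq, Complex.star_def,
    Complex.conj_ofReal] at h
  exact h

/-- The core real inequality `0 ≤ Re tr((1+tμV)ρ(1+tμV)(H − E₀ + tV + ½t²Q))`, expanded in `t, μ`
(positive operator in a positive functional). [cite: KLS1988JSP, eqs. (18)–(19)] -/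
theorem kls_trial_poly_nonneg (hH : H.IsHermitian) (hV : V.IsHermitian) (hρ : ρ.PosSemidef)
    (hHρ : H * ρ = (H.groundEnergy : ℂ) • ρ)
    (hGD : ∀ t : ℝ, H.groundEnergy ≤
      (H + (t : ℂ) • V + ((t ^ 2 * Q / 2 : ℝ) : ℂ) • (1 : Matrix m m ℂ)).groundEnergy) (t μ : ℝ) :
    0 ≤ t * (ρ * V).trace.re + (t ^ 2 * Q / 2) * ρ.trace.re +
      (2 * (t * μ)) * (t * (ρ * (V * V)).trace.re + (t ^ 2 * Q / 2) * (ρ * V).trace.re) +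
      (t * μ) ^ 2 * ((ρ * (V * (H - (H.groundEnergy : ℂ) • 1) * V)).trace.re +
        t * (ρ * (V * V * V)).trace.re + (t ^ 2 * Q / 2) * (ρ * (V * V)).trace.re) := by
  set K : Matrix m m ℂ := H - (H.groundEnergy : ℂ) • 1 with hK_def
  have hKρ : K * ρ = 0 := by
    rw [hK_def, sub_mul, hHρ, Matrix.smul_mul, one_mul, sub_self]
  have hρK : ρ * K = 0 := by
    rw [hK_def, mul_sub, mul_eq_smul_of_hermitian hH hρ.1 hHρ, Matrix.mul_smul, mul_one, sub_self]
  -- `M_t = K + tV + ½t²Q ⪰ 0`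
  have hM : (K + (t : ℂ) • V + ((t ^ 2 * Q / 2 : ℝ) : ℂ) • (1 : Matrix m m ℂ)).PosSemidef := by
    have hX : (H + (t : ℂ) • V + ((t ^ 2 * Q / 2 : ℝ) : ℂ) • (1 : Matrix m m ℂ)).IsHermitian :=
      (hH.add (hV.ofReal_smul t)).add (isHermitian_one.ofReal_smul _)
    have h := posSemidef_sub_of_groundEnergy_le hX (hGD t)
    convert h using 1
    rw [hK_def]
    abel
  -- `(1 + sV) ρ (1 + sV) ⪰ 0`
  have hS : ((1 + ((t * μ : ℝ) : ℂ) • V) * ρ * (1 + ((t * μ : ℝ) : ℂ) • V)).PosSemidef := by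
    have h := hρ.mul_mul_conjTranspose_same (1 + ((t * μ : ℝ) : ℂ) • V)
    rwa [conjTranspose_add, conjTranspose_one, conjTranspose_smul, hV.eq, Complex.star_def,
      Complex.conj_ofReal] at h
  have h0 := Literature.LinearAlgebra.Matrix.re_trace_mul_nonneg_of_posSemidef hS hM
  rw [trace_conj_trial_mul_expansion hKρ hρK t (t * μ) (t ^ 2 * Q / 2)] at h0
  simpa only [Complex.add_re, Complex.re_ofReal_mul] using h0

/-- **First order: `(GD_V,Q)` centres `V` in every ground state**: `tr(ρV) = 0` for every `ρ ⪰ 0`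
with `Hρ = E₀ρ` (a linear energy gain `t⟨V⟩` would beat the quadratic allowance).
[cite: KLS1988JSP, eqs. (18)–(19)] -/
theorem trace_mul_eq_zero_of_gaussianDomination (hH : H.IsHermitian) (hV : V.IsHermitian)
    (hρ : ρ.PosSemidef) (hHρ : H * ρ = (H.groundEnergy : ℂ) • ρ)
    (hGD : ∀ t : ℝ, H.groundEnergy ≤
      (H + (t : ℂ) • V + ((t ^ 2 * Q / 2 : ℝ) : ℂ) • (1 : Matrix m m ℂ)).groundEnergy) :
    (ρ * V).trace = 0 := by
  set v₁ : ℝ := (ρ * V).trace.re with hv₁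
  -- real part: discriminant of `½Q·trρ·t² + v₁ t ≥ 0`
  have hre : v₁ = 0 := by
    have hq : ∀ x : ℝ, 0 ≤ Q / 2 * ρ.trace.re * (x * x) + v₁ * x + 0 := by
      intro x
      have := kls_trial_poly_nonneg hH hV hρ hHρ hGD x 0
      simp only [mul_zero, zero_mul, add_zero, ne_eq, OfNat.ofNat_ne_zero, not_false_eq_true,
        zero_pow] at this
      nlinarith [this]
    have hd := discrim_le_zero hq
    rw [discrim] at hd
    nlinarith [sq_nonneg v₁]
  -- imaginary part: `tr(ρV)` is real for Hermitian `ρ`, `V`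
  have him : (ρ * V).trace.im = 0 := by
    have h : star (ρ * V).trace = (ρ * V).trace := by
      rw [← trace_conjTranspose, conjTranspose_mul, hρ.1.eq, hV.eq, trace_mul_comm]
    have := congrArg Complex.im h
    rw [Complex.star_def, Complex.conj_im] at this
    linarith
  exact Complex.ext (by rw [← hv₁, hre, Complex.zero_re]) (by rw [him, Complex.zero_im])

/-- **Second-order perturbation theory, variationally, in every ground state** (any `ρ ⪰ 0` with
`Hρ = E₀ρ` instead of the tracial state): under `(GD_V,Q)`, for every real `μ`,
`0 ≤ ½Q · Re trρ + 2μ · Re tr(ρV²) + μ² · Re tr(ρ V(H−E₀)V)`. [cite: KLS1988JSP, eqs. (18)–(19)] -/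
theorem infraredBound_quadratic_of_groundSupported (hH : H.IsHermitian) (hV : V.IsHermitian)
    (hρ : ρ.PosSemidef) (hHρ : H * ρ = (H.groundEnergy : ℂ) • ρ)
    (hGD : ∀ t : ℝ, H.groundEnergy ≤
      (H + (t : ℂ) • V + ((t ^ 2 * Q / 2 : ℝ) : ℂ) • (1 : Matrix m m ℂ)).groundEnergy) (μ : ℝ) :
    0 ≤ Q / 2 * ρ.trace.re + 2 * μ * (ρ * (V * V)).trace.re +
      μ ^ 2 * (ρ * (V * (H - (H.groundEnergy : ℂ) • 1) * V)).trace.re := by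
  have hv0 : (ρ * V).trace.re = 0 := by
    rw [trace_mul_eq_zero_of_gaussianDomination hH hV hρ hHρ hGD, Complex.zero_re]
  set a : ℝ := (ρ * (V * V)).trace.re
  set b : ℝ := (ρ * (V * (H - (H.groundEnergy : ℂ) • 1) * V)).trace.re
  set c₃ : ℝ := (ρ * (V * V * V)).trace.re
  have hquad : 0 ≤ b * (μ * μ) + 2 * a * μ + Q / 2 * ρ.trace.re := by
    refine nonneg_of_forall_ne_zero_poly (g := μ ^ 2 * c₃) (h := μ ^ 2 * (Q / 2) * a)
      fun t ht => ?_
    have h1 := kls_trial_poly_nonneg hH hV hρ hHρ hGD t μ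
    rw [hv0] at h1
    have ht2 : 0 < t ^ 2 := by positivity
    refine (mul_nonneg_iff_of_pos_left ht2).1 ?_
    nlinarith [h1]
  nlinarith [hquad]

/-- **The ground-state infrared bound in every ground state** (abstract Kennedy–Lieb–Shastry): under
`(GD_V,Q)`, for every `ρ ⪰ 0` with `Hρ = E₀ρ`, `(Re tr(ρV²))² ≤ ½Q · Re trρ · Re tr(ρ V(H−E₀)V)` — the
Cauchy–Schwarz step (12) with the susceptibility bound (14), as a discriminant; for `ρ = P₀` it is the
tree's `Matrix.groundState_infraredBound` up to the factor `tr P₀`. [cite: KLS1988JSP, eqs. (12), (14)] -/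
theorem infraredBound_of_groundSupported (hH : H.IsHermitian) (hV : V.IsHermitian)
    (hρ : ρ.PosSemidef) (hHρ : H * ρ = (H.groundEnergy : ℂ) • ρ)
    (hGD : ∀ t : ℝ, H.groundEnergy ≤
      (H + (t : ℂ) • V + ((t ^ 2 * Q / 2 : ℝ) : ℂ) • (1 : Matrix m m ℂ)).groundEnergy) :
    (ρ * (V * V)).trace.re ^ 2 ≤
      Q / 2 * ρ.trace.re * (ρ * (V * (H - (H.groundEnergy : ℂ) • 1) * V)).trace.re := by
  have hq : ∀ x : ℝ, 0 ≤ (ρ * (V * (H - (H.groundEnergy : ℂ) • 1) * V)).trace.re * (x * x) +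
      2 * (ρ * (V * V)).trace.re * x + Q / 2 * ρ.trace.re := by
    intro x
    have h := infraredBound_quadratic_of_groundSupported hH hV hρ hHρ hGD x
    linarith [h]
  have hd := discrim_le_zero hq
  rw [discrim] at hd
  nlinarith [hd]

/-- **Double-commutator form** (Kennedy–Lieb–Shastry eqs. (12)–(13)): under `(GD_V,Q)`, for every
`ρ ⪰ 0` with `Hρ = E₀ρ`, `(Re tr(ρV²))² ≤ ¼Q · Re trρ · Re tr(ρ[V,[H,V]])`,
`[V,[H,V]] = V(HV − VH) − (HV − VH)V`. [cite: KLS1988JSP, eqs. (12)–(13)] -/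
theorem infraredBound_doubleCommutator_of_groundSupported (hH : H.IsHermitian) (hV : V.IsHermitian)
    (hρ : ρ.PosSemidef) (hHρ : H * ρ = (H.groundEnergy : ℂ) • ρ)
    (hGD : ∀ t : ℝ, H.groundEnergy ≤
      (H + (t : ℂ) • V + ((t ^ 2 * Q / 2 : ℝ) : ℂ) • (1 : Matrix m m ℂ)).groundEnergy) :
    (ρ * (V * V)).trace.re ^ 2 ≤
      Q / 4 * ρ.trace.re * (ρ * (V * (H * V - V * H) - (H * V - V * H) * V)).trace.re := by
  have h := infraredBound_of_groundSupported hH hV hρ hHρ hGD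
  rw [trace_mul_sub_mul_eq_half_doubleCommutator hHρ (mul_eq_smul_of_hermitian hH hρ.1 hHρ),
    show (1 / 2 : ℂ) = ((1 / 2 : ℝ) : ℂ) by push_cast; ring, Complex.re_ofReal_mul] at h
  linarith [h]

/-- **Certified-input corollary (the mode ceiling).** For a ground-supported density matrix
(`ρ ⪰ 0`, `Hρ = E₀ρ`, `tr ρ = 1`), a Gaussian-domination-type constant `Q ≥ 0` for the mode `V` and a
double-commutator ceiling `Re tr(ρ[V,[H,V]]) ≤ D` give `Re tr(ρV²) ≤ ½√(Q·D)` — the per-mode input of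
the Kennedy–Lieb–Shastry sum-rule step, from finitely many certified numbers instead of the
reflection-positivity formulas. [cite: KLS1988JSP, eqs. (12)–(14)] -/
theorem trace_sq_le_half_sqrt_of_groundSupported (hH : H.IsHermitian) (hV : V.IsHermitian)
    (hρ : ρ.PosSemidef) (hHρ : H * ρ = (H.groundEnergy : ℂ) • ρ) (htr : ρ.trace = 1) (hQ : 0 ≤ Q)
    (hGD : ∀ t : ℝ, H.groundEnergy ≤
      (H + (t : ℂ) • V + ((t ^ 2 * Q / 2 : ℝ) : ℂ) • (1 : Matrix m m ℂ)).groundEnergy)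
    {D : ℝ} (hD : (ρ * (V * (H * V - V * H) - (H * V - V * H) * V)).trace.re ≤ D) :
    (ρ * (V * V)).trace.re ≤ Real.sqrt (Q * D) / 2 := by
  have h := infraredBound_doubleCommutator_of_groundSupported hH hV hρ hHρ hGD
  rw [htr, Complex.one_re, mul_one] at h
  -- `a = Re tr(ρ V²) ≥ 0`
  have ha : 0 ≤ (ρ * (V * V)).trace.re := by
    have hVV : (V * V).PosSemidef := by
      simpa only [hV.eq] using posSemidef_conjTranspose_mul_self V
    exact Literature.LinearAlgebra.Matrix.re_trace_mul_nonneg_of_posSemidef hρ hVV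
  have h2 : (ρ * (V * V)).trace.re ^ 2 ≤ Q / 4 * D := by
    rcases hQ.eq_or_lt with hQ0 | hQpos
    · rw [← hQ0] at h ⊢; simpa using h
    · exact h.trans (by nlinarith [hD])
  have hQD : 0 ≤ Q * D := by nlinarith [sq_nonneg ((ρ * (V * V)).trace.re)]
  have h3 : (2 * (ρ * (V * V)).trace.re) ^ 2 ≤ Q * D := by nlinarith [h2]
  have h4 : 2 * (ρ * (V * V)).trace.re ≤ Real.sqrt (Q * D) := by
    rw [← Real.sqrt_sq (by linarith : 0 ≤ 2 * (ρ * (V * V)).trace.re)]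
    exact Real.sqrt_le_sqrt h3
  linarith

end GroundSupported

/-- Adding two nonnegative quadratic forms in one variable: `∀ μ, 0 ≤ cᵢ + 2aᵢμ + bᵢμ²` (`i = 1, 2`)
give `(a₁ + a₂)² ≤ (c₁ + c₂)(b₁ + b₂)` (discriminant of the sum; how the cosine and sine modes of one
wave vector combine in `xy_infraredBound_of_groundEnergy_le`). [folklore] -/
private theorem sq_add_le_of_quadratics_nonneg {a₁ b₁ c₁ a₂ b₂ c₂ : ℝ}
    (h₁ : ∀ μ : ℝ, 0 ≤ c₁ + 2 * μ * a₁ + μ ^ 2 * b₁) (h₂ : ∀ μ : ℝ, 0 ≤ c₂ + 2 * μ * a₂ + μ ^ 2 * b₂) :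
    (a₁ + a₂) ^ 2 ≤ (c₁ + c₂) * (b₁ + b₂) := by
  have hq : ∀ x : ℝ, 0 ≤ (b₁ + b₂) * (x * x) + 2 * (a₁ + a₂) * x + (c₁ + c₂) := by
    intro x
    have := h₁ x
    have := h₂ x
    nlinarith
  have hd := discrim_le_zero hq
  rw [discrim] at hd
  nlinarith [hd]

/-- **Two-mode infrared bound in every ground state.** For Hermitian modes `V₁, V₂` with constants
`Q₁, Q₂` (`(GD_Vᵢ,Qᵢ)`) and a ground-supported `ρ ⪰ 0`, `(Re tr(ρV₁²) + Re tr(ρV₂²))² ≤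
½(Q₁+Q₂) · Re trρ · (Re tr(ρV₁(H−E₀)V₁) + Re tr(ρV₂(H−E₀)V₂))`; with `V₁ = C_q`, `V₂ = D_q` the
cosine/sine waves this bounds `|Λ| S(q) = ⟨C_q²⟩ + ⟨D_q²⟩`. [cite: KLS1988JSP, eqs. (12)–(14)] -/
theorem infraredBound_twoModes_of_groundSupported {H V₁ V₂ ρ : Matrix m m ℂ} {Q₁ Q₂ : ℝ}
    (hH : H.IsHermitian) (hV₁ : V₁.IsHermitian) (hV₂ : V₂.IsHermitian) (hρ : ρ.PosSemidef)
    (hHρ : H * ρ = (H.groundEnergy : ℂ) • ρ)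
    (hGD₁ : ∀ t : ℝ, H.groundEnergy ≤
      (H + (t : ℂ) • V₁ + ((t ^ 2 * Q₁ / 2 : ℝ) : ℂ) • (1 : Matrix m m ℂ)).groundEnergy)
    (hGD₂ : ∀ t : ℝ, H.groundEnergy ≤
      (H + (t : ℂ) • V₂ + ((t ^ 2 * Q₂ / 2 : ℝ) : ℂ) • (1 : Matrix m m ℂ)).groundEnergy) :
    ((ρ * (V₁ * V₁)).trace.re + (ρ * (V₂ * V₂)).trace.re) ^ 2 ≤
      (Q₁ + Q₂) / 2 * ρ.trace.re *
        ((ρ * (V₁ * (H - (H.groundEnergy : ℂ) • 1) * V₁)).trace.re +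
          (ρ * (V₂ * (H - (H.groundEnergy : ℂ) • 1) * V₂)).trace.re) := by
  have h := sq_add_le_of_quadratics_nonneg
    (infraredBound_quadratic_of_groundSupported hH hV₁ hρ hHρ hGD₁)
    (infraredBound_quadratic_of_groundSupported hH hV₂ hρ hHρ hGD₂)
  linarith [h]

section Vector
variable {H V : Matrix m m ℂ} {Q : ℝ} {ψ : m → ℂ}

/-- `|ψ⟩⟨ψ|` is ground-supported when `Hψ = E₀ψ`. [folklore] -/
private theorem mul_vecMulVec_star_of_mulVec_eq (hψ : H *ᵥ ψ = (H.groundEnergy : ℂ) • ψ) :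
    H * vecMulVec ψ (star ψ) = (H.groundEnergy : ℂ) • vecMulVec ψ (star ψ) := by
  rw [mul_vecMulVec_eq, hψ, smul_vecMulVec]

/-- **First order, vector form.** Under `(GD_V,Q)`, every vector `ψ` with `Hψ = E₀ψ` has `⟨ψ, Vψ⟩ = 0`:
a Gaussian-domination-type energy bound centres the mode in every (possibly degenerate) ground state.
[cite: KLS1988JSP, eqs. (18)–(19)] -/
theorem dotProduct_mulVec_eq_zero_of_gaussianDomination (hH : H.IsHermitian) (hV : V.IsHermitian)
    (hψ : H *ᵥ ψ = (H.groundEnergy : ℂ) • ψ)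
    (hGD : ∀ t : ℝ, H.groundEnergy ≤
      (H + (t : ℂ) • V + ((t ^ 2 * Q / 2 : ℝ) : ℂ) • (1 : Matrix m m ℂ)).groundEnergy) :
    star ψ ⬝ᵥ (V *ᵥ ψ) = 0 := by
  rw [← trace_vecMulVec_mul]
  exact trace_mul_eq_zero_of_gaussianDomination hH hV (posSemidef_vecMulVec_self_star ψ)
    (mul_vecMulVec_star_of_mulVec_eq hψ) hGD

/-- **The infrared bound for a ground-state vector** (Kennedy–Lieb–Shastry, J. Stat. Phys. 53 (1988),
eqs. (12), (14), (18)–(19), for ANY vector of a possibly degenerate ground level): under `(GD_V,Q)`,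
`(Re⟨ψ, V²ψ⟩)² ≤ ½Q · Re⟨ψ,ψ⟩ · Re⟨ψ, V(H−E₀)Vψ⟩`. [cite: KLS1988JSP, eqs. (12), (14), (18)–(19)] -/
theorem infraredBound_of_mulVec_eq (hH : H.IsHermitian) (hV : V.IsHermitian)
    (hψ : H *ᵥ ψ = (H.groundEnergy : ℂ) • ψ)
    (hGD : ∀ t : ℝ, H.groundEnergy ≤
      (H + (t : ℂ) • V + ((t ^ 2 * Q / 2 : ℝ) : ℂ) • (1 : Matrix m m ℂ)).groundEnergy) :
    (star ψ ⬝ᵥ ((V * V) *ᵥ ψ)).re ^ 2 ≤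
      Q / 2 * (star ψ ⬝ᵥ ψ).re * (star ψ ⬝ᵥ ((V * (H - (H.groundEnergy : ℂ) • 1) * V) *ᵥ ψ)).re := by
  have h := infraredBound_of_groundSupported hH hV (posSemidef_vecMulVec_self_star ψ)
    (mul_vecMulVec_star_of_mulVec_eq hψ) hGD
  rwa [trace_vecMulVec_mul, trace_vecMulVec_mul, trace_vecMulVec, dotProduct_comm ψ (star ψ)] at h

/-- The same for `Matrix.IsGroundStateVector` (the tree's ground-state-vector predicate: `ψ ≠ 0` in the
ground eigenspace), in double-commutator form:
`(Re⟨ψ, V²ψ⟩)² ≤ ¼Q · Re⟨ψ,ψ⟩ · Re⟨ψ, [V,[H,V]]ψ⟩`. [cite: KLS1988JSP, eqs. (12)–(13)] -/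
theorem infraredBound_of_isGroundStateVector (hH : H.IsHermitian) (hV : V.IsHermitian)
    (hψ : H.IsGroundStateVector ψ)
    (hGD : ∀ t : ℝ, H.groundEnergy ≤
      (H + (t : ℂ) • V + ((t ^ 2 * Q / 2 : ℝ) : ℂ) • (1 : Matrix m m ℂ)).groundEnergy) :
    (star ψ ⬝ᵥ ((V * V) *ᵥ ψ)).re ^ 2 ≤
      Q / 4 * (star ψ ⬝ᵥ ψ).re *
        (star ψ ⬝ᵥ ((V * (H * V - V * H) - (H * V - V * H) * V) *ᵥ ψ)).re := by
  have h := infraredBound_doubleCommutator_of_groundSupported hH hV (posSemidef_vecMulVec_self_star ψ)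
    (mul_vecMulVec_star_of_mulVec_eq hψ.2) hGD
  rwa [trace_vecMulVec_mul, trace_vecMulVec_mul, trace_vecMulVec, dotProduct_comm ψ (star ψ)] at h

end Vector

end Literature.MathematicalPhysics.QuantumLattice
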